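import Summits.PneNP.PneNP.Theses.KarlinRubin

/-!
# Crux `MonotoneSuffices` (stmt-PneNP-18026), line `Sketch` (compression flow) — stub `stub_gglrs`

The registered stub `stub_gglrs` of the skeleton
`Summits/PneNP/PneNP/Cruxes/MonotoneSuffices/Lines/Sketch.lean` (Kleitman down-up compression /
coordinate polarization): if a list `l` of edge coordinates contains EVERY coordinate, then folding the
compressions
`S_e g (x) = (g x[e←0] ∧ g x[e←1]) ∨ (x_e ∧ (g x[e←0] ∨ g x[e←1]))`
(on each `e`-edge `{x[e←0], x[e←1]}` of the cube the two values of `g` are replaced by `(min, max)`)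
over any Boolean function `f` on `EdgeVec n = ((⊤ : SimpleGraph (Fin n)).edgeSet → Bool)` gives a
`Monotone` function for the product order (`x ≤ y ↔ ∀ e, x e ≤ y e`, `false < true`). This is the
shifting lemma of Goldreich–Goldwasser–Lehman–Ron–Samorodnitsky (*Testing monotonicity*,
Combinatorica 20 (2000), Lemma 3: compressing along `e` does not destroy monotonicity along `d ≠ e`),
equivalently O'Donnell, *Analysis of Boolean Functions* (2014), the polarization exercise of Ch. 2.

Proof (all statements are about an ARBITRARY operator `S` satisfying the defining equation `hS` of the
compression, so that no definition is introduced). Say `g` is monotone IN DIRECTION `d` when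
`g x[d←0] ≤ g x[d←1]` for all `x`.
* `gglrs_compress_dir_self`: `S_e g` is monotone in direction `e` (both points of an `e`-edge see the
  same pair `(g x[e←0], g x[e←1])`, and `min ≤ max`);
* `gglrs_compress_dir_other`: if `g` is monotone in direction `d ≠ e` then so is `S_e g` (updates at
  `d` and `e` commute; on the square spanned by `d, e` both `min` and `max` are monotone maps —
  the pure-Boolean inequality `gglrs_bool_square`);
* `gglrs_foldr_dir`: by induction on `l`, `l.foldr S f` is monotone in every direction `d ∈ l`;
* `gglrs_monotone_of_forall_dir`: on a finite cube a function monotone in every coordinate direction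
  is `Monotone` (move from `x` to `y ≥ x` one differing coordinate at a time, by induction on a finset
  outside which `x` and `y` agree).

Nothing here is specific to graphs: the first four theorems are stated for any index type `ι` with
decidable equality (finite for the last one); `stub_gglrs` specialises to `ι = (⊤ : SimpleGraph (Fin n)).edgeSet`.
-/

set_option linter.dupNamespace false -- `Summit.PneNP.PneNP.…`: summit = sub-problem name (D-0017 single-conjunct layout)

namespace Summit.PneNP.PneNP.Theorems.MonotoneSuffices.Compression

open Literature.Computability.Complexity Literature.Probability.RandomGraphs.PlantedClique Filter Finset
open Function (update)

/-- On one edge of the cube the compressed values are `(min, max)` of the old pair `(a, b)`, and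
`min ≤ max`: `(a ∧ b) ∨ (0 ∧ (a ∨ b)) ≤ (a ∧ b) ∨ (1 ∧ (a ∨ b))`. [folklore] -/
theorem gglrs_bool_edge :
    ∀ (a b : Bool), (a && b || (false && (a || b))) ≤ (a && b || (true && (a || b))) := by
  decide

/-- The square inequality behind the shifting lemma: if `a₀ ≤ b₀` and `a₁ ≤ b₁` then
`MAJ₃(c, a₀, a₁) ≤ MAJ₃(c, b₀, b₁)`, i.e. `min` and `max` of the pair are monotone in the pair
(Goldreich–Goldwasser–Lehman–Ron–Samorodnitsky 2000, proof of Lemma 3). [folklore] -/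
theorem gglrs_bool_square :
    ∀ (a₀ a₁ b₀ b₁ c : Bool), a₀ ≤ b₀ → a₁ ≤ b₁ →
      (a₀ && a₁ || (c && (a₀ || a₁))) ≤ (b₀ && b₁ || (c && (b₀ || b₁))) := by
  decide

/-- **Compression is monotone in its own direction.** For any operator `S` given by the compression
formula `hS`, every `g` and every coordinate `e`: `S e g (x[e←0]) ≤ S e g (x[e←1])` (both sides are
computed from the same pair `(g x[e←0], g x[e←1])`, as `min` resp. `max`). [folklore] -/
theorem gglrs_compress_dir_self {ι : Type*} [DecidableEq ι]
    (S : ι → ((ι → Bool) → Bool) → (ι → Bool) → Bool)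
    (hS : ∀ (e : ι) (g : (ι → Bool) → Bool) (x : ι → Bool),
      S e g x = ((g (update x e false) && g (update x e true)) ||
        (x e && (g (update x e false) || g (update x e true)))))
    (g : (ι → Bool) → Bool) (e : ι) (x : ι → Bool) :
    S e g (update x e false) ≤ S e g (update x e true) := by
  simp only [hS, Function.update_idem, Function.update_self]
  exact gglrs_bool_edge _ _

/-- **GGLRS shifting lemma** (Goldreich–Goldwasser–Lehman–Ron–Samorodnitsky 2000, Lemma 3): compressing
along `e` preserves monotonicity in every other direction `d ≠ e`. If `g x[d←0] ≤ g x[d←1]` for all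
`x`, then the same holds for `S e g`: updates at `d` and `e` commute, `(x[d←a]) e = x e`, and on the
square `g_{ab} = g (x[e←b][d←a])` the hypothesis gives `g_{0b} ≤ g_{1b}`, whence
`MAJ₃(x e, g₀₀, g₀₁) ≤ MAJ₃(x e, g₁₀, g₁₁)` by `gglrs_bool_square`. [folklore] -/
theorem gglrs_compress_dir_other {ι : Type*} [DecidableEq ι]
    (S : ι → ((ι → Bool) → Bool) → (ι → Bool) → Bool)
    (hS : ∀ (e : ι) (g : (ι → Bool) → Bool) (x : ι → Bool),
      S e g x = ((g (update x e false) && g (update x e true)) ||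
        (x e && (g (update x e false) || g (update x e true)))))
    (g : (ι → Bool) → Bool) {d e : ι} (hde : d ≠ e)
    (hg : ∀ x : ι → Bool, g (update x d false) ≤ g (update x d true)) (x : ι → Bool) :
    S e g (update x d false) ≤ S e g (update x d true) := by
  simp only [hS, Function.update_of_ne hde.symm, Function.update_comm hde]
  exact gglrs_bool_square _ _ _ _ _ (hg _) (hg _)

/-- **A pass of compressions is monotone in every direction it visited.** For any operator `S` given
by the compression formula `hS` and any `f`, the right fold `l.foldr S f = S_{e₁} (S_{e₂} (⋯ f))` is
monotone in direction `d` for every `d ∈ l` (induction on `l`: the head direction by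
`gglrs_compress_dir_self`, the tail directions by the induction hypothesis and the shifting lemma
`gglrs_compress_dir_other`). [folklore] -/
theorem gglrs_foldr_dir {ι : Type*} [DecidableEq ι]
    (S : ι → ((ι → Bool) → Bool) → (ι → Bool) → Bool)
    (hS : ∀ (e : ι) (g : (ι → Bool) → Bool) (x : ι → Bool),
      S e g x = ((g (update x e false) && g (update x e true)) ||
        (x e && (g (update x e false) || g (update x e true)))))
    (f : (ι → Bool) → Bool) :
    ∀ (l : List ι) (d : ι), d ∈ l → ∀ x : ι → Bool,
      l.foldr S f (update x d false) ≤ l.foldr S f (update x d true) := by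
  intro l
  induction l with
  | nil =>
    intro d hd
    cases hd
  | cons e l ih =>
    intro d hd x
    rw [List.foldr_cons]
    by_cases hde : d = e
    · subst hde
      exact gglrs_compress_dir_self S hS _ d x
    · exact gglrs_compress_dir_other S hS _ hde
        (ih d ((List.mem_cons.1 hd).resolve_left hde)) x

/-- **Coordinatewise monotone functions on a finite cube are monotone.** If `h : (ι → Bool) → Bool`
satisfies `h x[d←0] ≤ h x[d←1]` for every coordinate `d` and every `x` (finite `ι`), then `h` is
`Monotone` for the product order: given `x ≤ y`, replace the coordinates of `x` by those of `y` one at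
a time (induction on a finset outside which `x` and `y` agree); each step is an instance of the
hypothesis or an equality. [folklore] -/
theorem gglrs_monotone_of_forall_dir {ι : Type*} [DecidableEq ι] [Fintype ι]
    (h : (ι → Bool) → Bool)
    (hdir : ∀ (d : ι) (x : ι → Bool), h (update x d false) ≤ h (update x d true)) :
    Monotone h := by
  -- `h x ≤ h y` whenever `x ≤ y` agree outside a finset `s`, by induction on `s`
  have key : ∀ (s : Finset ι) (x y : ι → Bool), x ≤ y → (∀ i, i ∉ s → x i = y i) → h x ≤ h y := by
    intro s
    induction s using Finset.induction_on with
    | empty =>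
      intro x y _ hxy
      have hxy' : x = y := funext fun i => hxy i (Finset.notMem_empty i)
      subst hxy'
      exact le_rfl
    | insert i s _ ih =>
      intro x y hle hxy
      -- one step in direction `i` …
      have hstep : ∀ a b : Bool, a ≤ b → h (update x i a) ≤ h (update x i b) := by
        intro a b hab
        cases a <;> cases b
        · exact le_rfl
        · exact hdir i x
        · exact absurd hab (by decide)
        · exact le_rfl
      have h1 : h x ≤ h (update x i (y i)) := by
        have h2 := hstep (x i) (y i) (hle i)
        rwa [Function.update_eq_self] at h2
      -- … then the induction hypothesis for the pair `(x[i ← y i], y)`, which agrees outside `s`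
      refine h1.trans (ih (update x i (y i)) y ?_ ?_)
      · intro j
        by_cases hji : j = i
        · subst hji
          rw [Function.update_self]
        · rw [Function.update_of_ne hji]
          exact hle j
      · intro j hj
        by_cases hji : j = i
        · subst hji
          rw [Function.update_self]
        · rw [Function.update_of_ne hji]
          exact hxy j fun hjs => absurd ((Finset.mem_insert.1 hjs).resolve_left hji) hj
  intro x y hle
  exact key Finset.univ x y hle fun i hi => absurd (Finset.mem_univ i) hi

/-- **stub_gglrs** (registered stub of line `Sketch`, crux stmt-PneNP-18026; the
Goldreich–Goldwasser–Lehman–Ron–Samorodnitsky shifting lemma in the form the line consumes). If the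
list `l` contains every edge coordinate of `K_n`, then folding the down-up compressions
`S_e g (x) = (g x[e←0] ∧ g x[e←1]) ∨ (x_e ∧ (g x[e←0] ∨ g x[e←1]))`, `e ∈ l`, over ANY test
`f : EdgeVec n → Bool` yields a `Monotone` Boolean function for the product order on `EdgeVec n`
(duplicates and order in `l` are irrelevant). Proof: `gglrs_foldr_dir` (monotone in every direction of
`l`, i.e. in every direction) and `gglrs_monotone_of_forall_dir`. [folklore] -/
theorem stub_gglrs :
    ∀ (n : ℕ) (l : List ((⊤ : SimpleGraph (Fin n)).edgeSet)) (f : EdgeVec n → Bool),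
      (∀ e, e ∈ l) →
      Monotone (l.foldr (fun e g x => (g (update x e false) && g (update x e true)) ||
        (x e && (g (update x e false) || g (update x e true)))) f) := by
  intro n l f hl
  refine gglrs_monotone_of_forall_dir _ fun d x => ?_
  exact gglrs_foldr_dir
    (fun e (g : EdgeVec n → Bool) (x : EdgeVec n) => (g (update x e false) && g (update x e true)) ||
      (x e && (g (update x e false) || g (update x e true))))
    (fun _ _ _ => rfl) f l d (hl d) x

end Summit.PneNP.PneNP.Theorems.MonotoneSuffices.Compression
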